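import Summits.ABC.IUTFork.Joshi.ATS4DescentSpineAbcThetaDivision
import HarnessLib

/-!
# [J-IV] (arXiv:2403.10430v2) §5.8 / §7.1: the prime `ℓ` of Lemma 5.8.7 and the whole CLASSICAL LAYER of the E5 spine's
# per-point antecedent EXIST off an exceptional set of bounded height — R-J census row Y-21k (`IsLem587Prime`) DECIDED-DERIVED

Proof-only companion (0 defs) of the abc-iut cell, branch E / R-J «Joshi Y-discharge census» (rung LADDER-ABC:A2.RESCUE.J; D-0079),
seat abc-iut-E-t30 (gen 5), lineage re-arm «E-t30 → Y-21» (E-plan 13:14:03Z); row Y-21k of `HOME/plan/E/R-J/Y-CENSUS.tsv`. Parents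
BUILT, every input BY NAME: E-t29's `IsLem587Prime` / `exists_threshold_P1_to_P6` (`Joshi/ATS4ExistenceLemmasCurves.lean`,
`Joshi/ATS4VojtaInputsSupply.lean`), E-t28's reading `ITDConditions` (`Joshi/ATS4InitialThetaDataExistence.lean`), E-t30 gen 3/4's
spines `abc_of_thetaTowerDescentInputs` (p443293) / `abc_of_descentInputs_exists` (p447878), the tree's `Cor22.partI_holds`,
`Cor22.logQForall_le_of_not_admitsCore`, `Cor22.exists_isThetaField`, `WeierstrassCurve.divisionField`. SOURCE: K. Joshi, *Construction of
Arithmetic Teichmüller Spaces IV*, arXiv:2403.10430v2 (unrefereed; bib `Joshi2024ATS4`): Lemma 5.8.7 p.55 l.37 – p.56 l.42, Thm. 5.7.1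
p.53 l.31–45 with «Completion of the Proof» p.57 l.17–26 («Let ℓ be a prime given by Lemma 5.8.7 … C_λ is equipped with an Initial
Theta Data with the prime ℓ»), §7.1 p.73 l.9–13 («let Exc be the set constructed in the proof of Theorem 5.7.1 … For C_λ ∉ Exc»);
page/line = the cell's render `HOME/lit/renders/Joshi-arxiv-2403.10430/`.

FRAMING (binding): classical number-field / λ-line statements PROVED in the tree, composed. NO side is taken on [IUTchIII] Cor. 3.12 /
[IUTchIV] Thm. 1.10, on Joshi's claims, or on Mochizuki's report on them; NO abc claim; typed ≠ proved ≠ endorsed.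

THE ROW. In the E5 spine `abc_of_thetaTowerDescentInputs` (p443293) the per-point antecedent is an existential block
«∃ F K ψ ℓ … (classical binders) … L_mod dd, glue ∧ nine §6.8–§6.11 inputs ∧ (IsLem587Prime d λ ℓ ∧ d_mod ≤ d)»; the R-J census
(Y-21) lists its conjuncts as letters a–k, letter k = T-29's `IsLem587Prime d λ ℓ` («ℓ a prime given by Lemma 5.8.7»: the window
`Q^{1/2} ≤ ℓ ≤ 10·δ·Q^{1/2}·log(2δQ)`, (P2) `ℓ ∤ a_v`, `a_v < Q^{1/2}` at `v ∣ ℓ`). WHAT IS PROVED HERE (row k DECIDED-DERIVED, kernel):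
1. `exists_isLem587Prime_itdConditions_offExc` — for every compactly bounded `Z` with (5.6.2) and every `d ≥ 1` there is an
   exceptional set of BOUNDED HEIGHT off which every `λ ∈ Z ∩ U(Q̄)_{≤d}` carries a prime `ℓ` with `IsLem587Prime d λ ℓ`, E-t28's
   `ITDConditions λ ℓ` (`7 ≤ ℓ`, (P2), (P5), (P6)) and `AdmitsCore λ` — Thm. 5.7.1's «Completion of the Proof» up to (P6) as ONE
   statement (E-t29's threshold `exists_threshold_P1_to_P6` raised above `12`, bounded height by Prop. 5.6.1 = `Cor22.partI_holds`).
2. `classicalLayer_offExc` — off the same kind of set, the WHOLE classical prefix of p443293's block is inhabited: a theta field `F`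
   of `λ`, print's `L′ = K = F(E_F[ℓ])` Galois over `F` with `ker ρ̄_{E_F,ℓ} ≤ Gal(F̄/ψK)`, `ℓ ≥ 7` prime of Lemma 5.8.7 with
   `ITDConditions`, `AdmitsCore`, and «`0 < log 𝔮_F`» (`V^{odd,ss} ≠ ∅`) — so letter k (and every classical binder) is a THEOREM, not
   a hypothesis: what remains of the block is exactly «∃ L_mod dd, d_mod ≤ d ∧ glue ∧ the nine §6.8–§6.11 inputs» (letters a, c–j +
   LowerBound; calibrated ⟺ ONE inequality (E) by E-t35's `MainBoundDatum.exists_glue_inputs_iff`, p446138).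
3. `thetaTowerDescentInputs_of_descentInputs_exists` — the two typed antecedents compared AS A THEOREM: the package-only
   antecedent of p447878's `abc_of_descentInputs_exists` (classical data GIVEN) implies p443293's antecedent (classical data
   DEMANDED); `abc_of_thetaTowerDescentInputs` ∘ this = p447878's theorem.
FACT rows used: none (inputs are theorems of the tree). Theorems only (6); standard axioms; no `sorry`, instance, notation, `def` or
new `Prop`. [claim: Joshi2024ATS4, status: disputed] for the locators.
-/

noncomputable section

namespace Summit.ABC.IUTFork.Joshi.ATS4

open Literature.NumberTheory.DiophantineGeometry Literature.NumberTheory.DiophantineGeometry.GenEll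
open Literature.NumberTheory.EllipticCurves
open Literature.IUT.LogVolume Literature.IUT.LogVolume.Cor22
open NumberField IsDedekindDomain

/-! ## 1. Row Y-21k: the prime of Lemma 5.8.7 (with Thm. 5.7.1's conditions) EXISTS off an exceptional set of bounded height -/

/-- **Thm. 5.7.1 «Completion of the Proof» up to (P6), as ONE statement** (p.57 l.17–26; §7.1 p.73 l.9–13): for `Z` compactly
bounded with (5.6.2) (`Cor22.Hypotheses`) and `d ≥ 1` there is `Exc ⊂ Z ∩ U(Q̄)_{≤d}` OF BOUNDED HEIGHT — here the curves with
`Tate(C_λ) ≤ max(B, 12)`, `B = B(Z, d)` E-t29's threshold (`exists_threshold_P1_to_P6`), `12` putting the coreless curves inside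
(`Cor22.logQForall_le_of_not_admitsCore`); bounded height by Prop. 5.6.1 = [IUTchIV] Cor. 2.2 (i) (`Cor22.partI_holds`) — off which
every `λ` carries a prime `ℓ` with T-29's `IsLem587Prime d λ ℓ` (Lemma 5.8.7 (1)–(3)), E-t28's `ITDConditions λ ℓ` («C_λ is equipped
with an Initial Theta Data with the prime ℓ»: `7 ≤ ℓ`, (P2), (P5), (P6)) and `AdmitsCore λ`. PROVED (classical; R-J row Y-21k).
[claim: Joshi2024ATS4, status: disputed] -/
theorem exists_isLem587Prime_itdConditions_offExc (D : CBData) (hD : Hypotheses D) {d : ℕ} (hd : 0 < d) :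
    ∃ Exc : Set NFPoint, (∃ H : ℝ, ∀ P ∈ Exc, P.ht ≤ H) ∧
      ∀ P ∈ D.toSet ∩ UPle d, P ∉ Exc → ∃ ℓ : ℕ, IsLem587Prime d P ℓ ∧ ITDConditions P ℓ ∧ AdmitsCore P := by
  obtain ⟨B, hB⟩ := exists_threshold_P1_to_P6 D hD hd
  obtain ⟨_, h23, h3⟩ := partI_holds D hD
  obtain ⟨C₀, hC₀⟩ := (h3.symm.trans h23.symm).bdLe
  refine ⟨{P | P ∈ D.toSet ∩ UPle d ∧ logQForall P ≤ max B 12}, ⟨1 / 6 * max B 12 + C₀, ?_⟩, ?_⟩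
  · rintro P ⟨⟨hPD, _⟩, hPB⟩
    have hx : NFPoint.ht P - 1 / 6 * logQForall P ≤ C₀ := hC₀ P hPD
    linarith
  · rintro P ⟨hPD, hPd⟩ hPexc
    have hgt : max B 12 < logQForall P := by
      by_contra hle
      exact hPexc ⟨⟨hPD, hPd⟩, not_lt.mp hle⟩
    obtain ⟨ℓ, hℓP, h7, hP5, hP6⟩ := hB P ⟨hPD, hPd⟩ (lt_of_le_of_lt (le_max_left _ _) hgt)
    have hcore : AdmitsCore P := by
      by_contra hno
      have := logQForall_le_of_not_admitsCore hno
      linarith [le_max_right B 12]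
    exact ⟨ℓ, hℓP, ⟨h7, hℓP.2.2.2.1, hP5, hP6⟩, hcore⟩

/-- A prime of Lemma 5.8.7 is prime (first conjunct of T-29's `IsLem587Prime`). [folklore] -/
theorem IsLem587Prime.prime {d : ℕ} {P : NFPoint} {ℓ : ℕ} (h : IsLem587Prime d P ℓ) : ℓ.Prime := h.1

/-- A prime of Lemma 5.8.7 satisfies (P2) `Cor22.CondP2 λ ℓ` («ℓ ∤ a_v», Lemma 5.8.7 (2)). [folklore] -/
theorem IsLem587Prime.condP2 {d : ℕ} {P : NFPoint} {ℓ : ℕ} (h : IsLem587Prime d P ℓ) : CondP2 P ℓ := h.2.2.2.1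

/-- **A prime of Lemma 5.8.7 for a curve with `Tate(C_λ) > 49` is `≥ 7`** (`ℓ ≥ Q^{1/2} > 7`; Joshi p.72 l.31 «Finally one uses ℓ ≥ 7»).
PROVED. [folklore] -/
theorem IsLem587Prime.seven_le {d : ℕ} {P : NFPoint} {ℓ : ℕ} (h : IsLem587Prime d P ℓ) (h49 : 49 < logQForall P) : 7 ≤ ℓ := by
  have h7s : (7 : ℝ) < Real.sqrt (logQForall P) := by
    rw [Real.lt_sqrt (by norm_num)]; linarith
  have : (7 : ℝ) < ℓ := lt_of_lt_of_le h7s h.2.1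
  exact_mod_cast this.le

/-! ## 2. The whole classical prefix of p443293's per-point block is inhabited off `Exc` -/

/-- **The CLASSICAL LAYER of the E5 spine's per-point antecedent EXISTS off an exceptional set of bounded height.** For `Z` with
(5.6.2) and `d ≥ 1`, off a set of bounded height, every `λ ∈ Z ∩ U(Q̄)_{≤d}` carries: a theta field `F` of `λ` (`Cor22.IsThetaField`,
Joshi's `L`, §4.1.2 (9); `Cor22.exists_isThetaField`), a number field `K ⊇ F` Galois over `F` with an `F`-embedding `ψ : K → F̄` onto
the `ℓ`-division field `F(E_F[ℓ])` (print's `L′`; [IUTchI] Def. 3.1 (c); `exists_thetaField_divisionField`) — so `ker ρ̄_{E_F,ℓ} ≤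
Gal(F̄/ψK)` —, a prime `ℓ ≥ 7` (`≥ 5`) with `IsLem587Prime d λ ℓ`, `ITDConditions λ ℓ`, `AdmitsCore λ`, and «`0 < log 𝔮_F`» at the theta
datum over `F` (Thm. 6.1.1's «V^{odd,ss} ≠ ∅» = (P5), `TateDivisorDatum.logq_ofNFPointOver_pos_iff_condP5`). These are EXACTLY the
binders of p443293's block that precede «∃ L_mod dd, glue ∧ nine inputs ∧ d_mod ≤ d»: every one is a theorem. PROVED (classical).
[claim: Joshi2024ATS4, status: disputed] -/
theorem classicalLayer_offExc (D : CBData) (hD : Hypotheses D) {d : ℕ} (hd : 0 < d) :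
    ∃ Exc : Set NFPoint, (∃ H : ℝ, ∀ P ∈ Exc, P.ht ≤ H) ∧
      ∀ P ∈ D.toSet ∩ UPle d, P ∉ Exc →
        ∃ (F : Type) (_ : Field F) (_ : NumberField F) (_ : Algebra P.F F)
          (K : Type) (_ : Field K) (_ : NumberField K) (_ : Algebra F K) (_ : Algebra P.F K) (_ : IsScalarTower P.F F K)
          (_ : IsGalois F K) (ψ : K →ₐ[F] AlgebraicClosure F) (ℓ : ℕ) (_ : ℓ.Prime) (_ : 5 ≤ ℓ)
          (hU : P.InU) (_ : IsThetaField P F)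
          (_ : letI := thetaCurve_isElliptic hU F
            ((thetaCurve P F).galoisRepTorsion (ℓ : ℤ)).ker ≤ ψ.fieldRange.fixingSubgroup)
          (_ : 0 < (TateDivisorDatum.ofNFPointOver P {2, ℓ} F).logq),
          IsLem587Prime d P ℓ ∧ 7 ≤ ℓ ∧ ITDConditions P ℓ ∧ AdmitsCore P ∧
            ψ.fieldRange = (thetaCurve P F).divisionField ℓ := by
  obtain ⟨Exc, hExc, hoff⟩ := exists_isLem587Prime_itdConditions_offExc D hD hd
  refine ⟨Exc, hExc, fun P hP hnot => ?_⟩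
  obtain ⟨ℓ, hℓP, hITD, hcore⟩ := hoff P hP hnot
  have hℓ : ℓ.Prime := hℓP.1
  have h7 : 7 ≤ ℓ := hITD.1
  have hU : P.InU := hP.2.1.1
  obtain ⟨F, _, _, _, K, _, _, _, _, _, _, ψ, hF, hKψ, hK⟩ := exists_thetaField_divisionField hU hℓ
  have hq : 0 < (TateDivisorDatum.ofNFPointOver P {2, ℓ} F).logq :=
    (TateDivisorDatum.logq_ofNFPointOver_pos_iff_condP5 P ℓ F).2 hITD.2.2.1
  exact ⟨F, inferInstance, inferInstance, inferInstance, K, inferInstance, inferInstance, inferInstance, inferInstance,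
    inferInstance, inferInstance, ψ, ℓ, hℓ, le_trans (by norm_num) h7, hU, hF, hK, hq, hℓP, h7, hITD, hcore, hKψ⟩

/-! ## 3. The two typed antecedents compared: classical data GIVEN (p447878) implies classical data DEMANDED (p443293) -/

/-- **p447878's package-only antecedent implies p443293's antecedent.** If, for every `d ≥ 1`, every minimally presented
`λ ∈ U(Q̄)_{≤d}` and every prime `ℓ` of Lemma 5.8.7 with `ITDConditions λ ℓ` and `AdmitsCore λ` (classical data GIVEN), the supplier
returns a theta field, a `K` inside the division field, «0 < log 𝔮_F», `L_mod` with `d_mod ≤ d` and E-t31's carrier glued with its nine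
NAMED §6.8–§6.11 inputs (the antecedent of `abc_of_descentInputs_exists`, p447878), then the antecedent of p443293's
`abc_of_thetaTowerDescentInputs` holds (there the same data are DEMANDED per point off an exceptional set, together with
`IsLem587Prime d λ ℓ ∧ 7 ≤ ℓ`): the classical binders — letter k of the R-J census among them — are supplied by
`exists_isLem587Prime_itdConditions_offExc`. PROVED; `abc_of_thetaTowerDescentInputs ∘` this is p447878's theorem. Nothing of
§6.8–§6.11 or of [J-III] is discharged; NO abc claim. [claim: Joshi2024ATS4, status: disputed] -/
theorem thetaTowerDescentInputs_of_descentInputs_exists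
    (h : ∀ (d : ℕ), 0 < d → ∀ P ∈ UPle d, ∀ (ℓ : ℕ) (hℓ : ℓ.Prime) (h5 : 5 ≤ ℓ), IsLem587Prime d P ℓ → ITDConditions P ℓ →
      AdmitsCore P →
        ∃ (F : Type) (_ : Field F) (_ : NumberField F) (_ : Algebra P.F F)
          (K : Type) (_ : Field K) (_ : NumberField K) (_ : Algebra F K) (_ : Algebra P.F K) (_ : IsScalarTower P.F F K)
          (_ : IsGalois F K) (ψ : K →ₐ[F] AlgebraicClosure F) (hU : P.InU) (_ : IsThetaField P F)
          (_ : letI := thetaCurve_isElliptic hU F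
            ((thetaCurve P F).galoisRepTorsion (ℓ : ℤ)).ker ≤ ψ.fieldRange.fixingSubgroup)
          (hq : 0 < (TateDivisorDatum.ofNFPointOver P {2, ℓ} F).logq)
          (Lmod : Type) (_ : Field Lmod) (_ : NumberField Lmod) (dd : LocusVolumeDatum),
          MainBoundGlue (MainBoundDatum.ofGenuine Lmod hℓ h5 (TateDivisorDatum.ofNFPoint P {2, ℓ})
            (TateDivisorDatum.ofNFPointOver P {2, ℓ} F) (TateDivisorDatum.ofNFPointOver P {2, ℓ} K) hq) dd ∧
          (dd.Eq6111 ∧ (∀ p ∈ dd.Vdst, dd.Prop6109 p) ∧ dd.ComponentSums ∧ dd.Eq6811 ∧ dd.Lem678 ∧ dd.LowerBound ∧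
            dd.FrobShiftQ ∧ dd.FrobShiftVol ∧ dd.LogqDictionary) ∧
          dMod Lmod ≤ d) :
    ∀ Z : CBData, Hypotheses Z → ∀ d : ℕ, 0 < d → ∃ Exc : Set NFPoint, (∃ H : ℝ, ∀ P ∈ Exc, P.ht ≤ H) ∧
      ∀ P ∈ Z.toSet ∩ UPle d, P ∉ Exc →
        ∃ (F : Type) (_ : Field F) (_ : NumberField F) (_ : Algebra P.F F)
          (K : Type) (_ : Field K) (_ : NumberField K) (_ : Algebra F K) (_ : Algebra P.F K) (_ : IsScalarTower P.F F K)
          (_ : IsGalois F K) (ψ : K →ₐ[F] AlgebraicClosure F) (ℓ : ℕ) (hℓ : ℓ.Prime) (h5 : 5 ≤ ℓ)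
          (hU : P.InU) (_ : IsThetaField P F)
          (_ : letI := thetaCurve_isElliptic hU F
            ((thetaCurve P F).galoisRepTorsion (ℓ : ℤ)).ker ≤ ψ.fieldRange.fixingSubgroup)
          (hq : 0 < (TateDivisorDatum.ofNFPointOver P {2, ℓ} F).logq)
          (Lmod : Type) (_ : Field Lmod) (_ : NumberField Lmod) (dd : LocusVolumeDatum),
          MainBoundGlue (MainBoundDatum.ofGenuine Lmod hℓ h5 (TateDivisorDatum.ofNFPoint P {2, ℓ})
            (TateDivisorDatum.ofNFPointOver P {2, ℓ} F) (TateDivisorDatum.ofNFPointOver P {2, ℓ} K) hq) dd ∧ 7 ≤ ℓ ∧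
          (dd.Eq6111 ∧ (∀ p ∈ dd.Vdst, dd.Prop6109 p) ∧ dd.ComponentSums ∧ dd.Eq6811 ∧ dd.Lem678 ∧ dd.LowerBound ∧
            dd.FrobShiftQ ∧ dd.FrobShiftVol ∧ dd.LogqDictionary) ∧
          (IsLem587Prime d P ℓ ∧ dMod Lmod ≤ d) := by
  intro Z hZ d hd
  obtain ⟨Exc, hExc, hoff⟩ := exists_isLem587Prime_itdConditions_offExc Z hZ hd
  refine ⟨Exc, hExc, fun P hP hnot => ?_⟩
  obtain ⟨ℓ, hℓP, hITD, hcore⟩ := hoff P hP hnot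
  have h7 : 7 ≤ ℓ := hITD.1
  obtain ⟨F, _, _, _, K, _, _, _, _, _, _, ψ, hU, hF, hK, hq, Lmod, _, _, dd, G, nine, hdmod⟩ :=
    h d hd P hP.2 ℓ hℓP.1 (le_trans (by norm_num) h7) hℓP hITD hcore
  exact ⟨F, inferInstance, inferInstance, inferInstance, K, inferInstance, inferInstance, inferInstance, inferInstance,
    inferInstance, inferInstance, ψ, ℓ, hℓP.1, le_trans (by norm_num) h7, hU, hF, hK, hq, Lmod, inferInstance, inferInstance, dd,
    G, h7, nine, hℓP, hdmod⟩

-- Remark (no declaration, the gate's dedup would identify it with p447878's theorem): p447878's ∃-form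
-- `abc_of_descentInputs_exists h` is literally `abc_of_thetaTowerDescentInputs (thetaTowerDescentInputs_of_descentInputs_exists h)`.

end Summit.ABC.IUTFork.Joshi.ATS4

end
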